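import Literature.Analysis.Fourier.BeurlingFunction
import HarnessLib

/-!
# Selberg's majorant and minorant of the indicator of an interval

Topic `Literature/Analysis/Fourier`. Everything in this file is PROVED (definitions with bodies
and theorems; no named facts).

A. Selberg's construction (see J. D. Vaaler, *Some extremal functions in Fourier analysis*,
Bull. AMS 12 (1985), Theorem 8 and (2.1)–(2.5); H. L. Montgomery, *Ten lectures…*, Ch. 1,
Lemma 5 / (20)): for `Δ > 0` and an interval `[a, b]`, with Beurling's function `B`
(`Literature.Analysis.Fourier.beurling`, `BeurlingFunction.lean`),

  `F₊(z) = ½ ( B(Δ(z − a)) + B(Δ(b − z)) )`,  `F₋(z) = −½ ( B(Δ(a − z)) + B(Δ(z − b)) )`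

are entire functions of exponential type `2πΔ` with

* (i) `F₋ ≤ 𝟙_{(a,b)} ≤ 𝟙_{[a,b]} ≤ F₊` on `ℝ` (`selbergMinorantReal_le_indicator`,
  `indicator_le_selbergMajorantReal`);
* (ii) `∫ (F₊ − 𝟙_{[a,b]}) = 1/Δ = ∫ (𝟙_{[a,b]} − F₋)` (`integral_selbergMajorantReal_sub_indicator`,
  `integral_indicator_sub_selbergMinorantReal`), hence `∫ F± = (b − a) ± 1/Δ`;
* (iv) `|F±(z)| ≤ K e^{2πΔ|Im z|} ((1 + (Re z − a)²)⁻¹ + (1 + (Re z − b)²)⁻¹)`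
  (`exists_norm_selbergMajorant_le`, `exists_norm_selbergMinorant_le`) and the far-field bounds
  `|F±(z)| ≤ 2e^{2πΔ|Im z|}/(Δ²(Re z − b)²)` for `Re z ≥ b + 1/Δ` (and symmetrically below `a`).

This is exactly Prop. 10 (i), (ii), (iv) of Balazard–de Roton, *Notes de lecture de l'article
"Partial sums of the Möbius function" de K. Soundararajan*, arXiv:0810.3587 (the Fourier-side
statement (iii) — `F̂±` vanishes off `[−Δ, Δ]` — is `SelbergMajorantsFourier.lean`).

## References

* [Vaaler1985] J. D. Vaaler, Bull. AMS 12 (1985), Thm. 8, §2 (2.1)–(2.5). [cite: Vaaler1985, Thm. 8]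
* [BalazardDeRoton2008] M. Balazard, A. de Roton, arXiv:0810.3587, Prop. 10.
* H. L. Montgomery, Ten lectures on the interface between analytic number theory and harmonic
  analysis, CBMS 84 (1994), Ch. 1 §2.
-/

noncomputable section

open Complex Filter Topology Set MeasureTheory Metric

open scoped Real

namespace Literature.Analysis.Fourier

/-! ## Definitions -/

/-- **Selberg's majorant** of `𝟙_{[a,b]}` with bandwidth `Δ`: `F₊(z) = ½(B(Δ(z−a)) + B(Δ(b−z)))`.
[cite: Vaaler1985, Thm. 8] -/
def selbergMajorant (Δ a b : ℝ) (z : ℂ) : ℂ :=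
  (beurling (Δ * (z - a)) + beurling (Δ * (b - z))) / 2

/-- **Selberg's minorant** of `𝟙_{[a,b]}`: `F₋(z) = −½(B(Δ(a−z)) + B(Δ(z−b)))`.
[cite: Vaaler1985, Thm. 8] -/
def selbergMinorant (Δ a b : ℝ) (z : ℂ) : ℂ :=
  -(beurling (Δ * (a - z)) + beurling (Δ * (z - b))) / 2

/-- `F₊` on the real line (real-valued). [cite: Vaaler1985, Thm. 8] -/
def selbergMajorantReal (Δ a b x : ℝ) : ℝ :=
  (beurlingReal (Δ * (x - a)) + beurlingReal (Δ * (b - x))) / 2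

/-- `F₋` on the real line (real-valued). [cite: Vaaler1985, Thm. 8] -/
def selbergMinorantReal (Δ a b x : ℝ) : ℝ :=
  -(beurlingReal (Δ * (a - x)) + beurlingReal (Δ * (x - b))) / 2

/-- `F₊(x) = selbergMajorantReal Δ a b x` for real `x`. [folklore] -/
theorem selbergMajorant_ofReal (Δ a b x : ℝ) :
    selbergMajorant Δ a b x = (selbergMajorantReal Δ a b x : ℂ) := by
  unfold selbergMajorant selbergMajorantReal
  have h1 : ((Δ : ℂ) * (x - a)) = ((Δ * (x - a) : ℝ) : ℂ) := by push_cast; ring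
  have h2 : ((Δ : ℂ) * (b - x)) = ((Δ * (b - x) : ℝ) : ℂ) := by push_cast; ring
  rw [h1, h2, beurling_ofReal, beurling_ofReal]
  push_cast; ring

/-- `F₋(x) = selbergMinorantReal Δ a b x` for real `x`. [folklore] -/
theorem selbergMinorant_ofReal (Δ a b x : ℝ) :
    selbergMinorant Δ a b x = (selbergMinorantReal Δ a b x : ℂ) := by
  unfold selbergMinorant selbergMinorantReal
  have h1 : ((Δ : ℂ) * (a - x)) = ((Δ * (a - x) : ℝ) : ℂ) := by push_cast; ring
  have h2 : ((Δ : ℂ) * (x - b)) = ((Δ * (x - b) : ℝ) : ℂ) := by push_cast; ring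
  rw [h1, h2, beurling_ofReal, beurling_ofReal]
  push_cast; ring

/-- `F₊` is entire. [cite: Vaaler1985, Thm. 8] -/
theorem differentiable_selbergMajorant (Δ a b : ℝ) : Differentiable ℂ (selbergMajorant Δ a b) := by
  unfold selbergMajorant
  refine ((differentiable_beurling.comp ?_).add (differentiable_beurling.comp ?_)).div_const _
  · exact (differentiable_id.sub_const _).const_mul _
  · exact ((differentiable_const _).sub differentiable_id).const_mul _

/-- `F₋` is entire. [cite: Vaaler1985, Thm. 8] -/
theorem differentiable_selbergMinorant (Δ a b : ℝ) : Differentiable ℂ (selbergMinorant Δ a b) := by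
  unfold selbergMinorant
  refine ((differentiable_beurling.comp ?_).add (differentiable_beurling.comp ?_)).neg.div_const _
  · exact ((differentiable_const _).sub differentiable_id).const_mul _
  · exact (differentiable_id.sub_const _).const_mul _

/-- `F₊` is continuous on `ℝ`. [folklore] -/
theorem continuous_selbergMajorantReal (Δ a b : ℝ) : Continuous (selbergMajorantReal Δ a b) := by
  unfold selbergMajorantReal
  exact ((continuous_beurlingReal.comp (by fun_prop)).add
    (continuous_beurlingReal.comp (by fun_prop))).div_const _

/-- `F₋` is continuous on `ℝ`. [folklore] -/
theorem continuous_selbergMinorantReal (Δ a b : ℝ) : Continuous (selbergMinorantReal Δ a b) := by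
  unfold selbergMinorantReal
  exact ((continuous_beurlingReal.comp (by fun_prop)).add
    (continuous_beurlingReal.comp (by fun_prop))).neg.div_const _

/-- The minorant is a reflected majorant: `F₋(z) = −F₊^{[b,a]}`-type symmetry, precisely
`selbergMinorant Δ a b z = −selbergMajorant Δ b a z`… in the form
`F₋^{[a,b]}(z) = −(B(Δ(a−z)) + B(Δ(z−b)))/2 = −F₊^{[b,a]}(z)`. [folklore] -/
theorem selbergMinorant_eq_neg_selbergMajorant (Δ a b : ℝ) (z : ℂ) :
    selbergMinorant Δ a b z = -selbergMajorant Δ b a z := by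
  unfold selbergMinorant selbergMajorant
  ring

/-- Real-line form of `selbergMinorant_eq_neg_selbergMajorant`. [folklore] -/
theorem selbergMinorantReal_eq_neg_selbergMajorantReal (Δ a b x : ℝ) :
    selbergMinorantReal Δ a b x = -selbergMajorantReal Δ b a x := by
  unfold selbergMinorantReal selbergMajorantReal
  ring

/-! ## (i) Majorant and minorant properties -/

/-- **`𝟙_{[a,b]} ≤ F₊`** on `ℝ` (for `Δ > 0`, `a ≤ b`). [cite: Vaaler1985, Thm. 8] -/
theorem indicator_le_selbergMajorantReal {Δ a b : ℝ} (hΔ : 0 < Δ) (hab : a ≤ b) (x : ℝ) :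
    (Icc a b).indicator (fun _ ↦ (1 : ℝ)) x ≤ selbergMajorantReal Δ a b x := by
  unfold selbergMajorantReal
  by_cases hx : x ∈ Icc a b
  · rw [indicator_of_mem hx]
    have h1 : 1 ≤ beurlingReal (Δ * (x - a)) := one_le_beurlingReal (by nlinarith [hx.1])
    have h2 : 1 ≤ beurlingReal (Δ * (b - x)) := one_le_beurlingReal (by nlinarith [hx.2])
    linarith
  · rw [indicator_of_notMem hx]
    rw [mem_Icc, not_and_or, not_le, not_le] at hx
    rcases hx with hx | hx
    · have h1 : -1 ≤ beurlingReal (Δ * (x - a)) := neg_one_le_beurlingReal _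
      have h2 : 1 ≤ beurlingReal (Δ * (b - x)) := one_le_beurlingReal (by nlinarith)
      linarith
    · have h1 : 1 ≤ beurlingReal (Δ * (x - a)) := one_le_beurlingReal (by nlinarith)
      have h2 : -1 ≤ beurlingReal (Δ * (b - x)) := neg_one_le_beurlingReal _
      linarith

/-- `0 ≤ F₊` on `ℝ`. [cite: Vaaler1985, Thm. 8] -/
theorem selbergMajorantReal_nonneg {Δ a b : ℝ} (hΔ : 0 < Δ) (hab : a ≤ b) (x : ℝ) :
    0 ≤ selbergMajorantReal Δ a b x :=
  le_trans (Set.indicator_nonneg (fun _ _ ↦ zero_le_one) x) (indicator_le_selbergMajorantReal hΔ hab x)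

/-- **`F₋ ≤ 𝟙_{(a,b)}`** on `ℝ` (for `Δ > 0`; no order hypothesis needed). [cite: Vaaler1985, Thm. 8] -/
theorem selbergMinorantReal_le_indicator {Δ : ℝ} (hΔ : 0 < Δ) (a b x : ℝ) :
    selbergMinorantReal Δ a b x ≤ (Ioo a b).indicator (fun _ ↦ (1 : ℝ)) x := by
  unfold selbergMinorantReal
  by_cases hx : x ∈ Ioo a b
  · rw [indicator_of_mem hx]
    have h1 : -1 ≤ beurlingReal (Δ * (a - x)) := neg_one_le_beurlingReal _
    have h2 : -1 ≤ beurlingReal (Δ * (x - b)) := neg_one_le_beurlingReal _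
    linarith
  · rw [indicator_of_notMem hx]
    rw [mem_Ioo, not_and_or, not_lt, not_lt] at hx
    rcases hx with hx | hx
    · have h1 : 1 ≤ beurlingReal (Δ * (a - x)) := one_le_beurlingReal (by nlinarith)
      have h2 : -1 ≤ beurlingReal (Δ * (x - b)) := neg_one_le_beurlingReal _
      linarith
    · have h1 : -1 ≤ beurlingReal (Δ * (a - x)) := neg_one_le_beurlingReal _
      have h2 : 1 ≤ beurlingReal (Δ * (x - b)) := one_le_beurlingReal (by nlinarith)
      linarith

/-- `F₋ ≤ 𝟙_{[a,b]}` on `ℝ`. [cite: Vaaler1985, Thm. 8] -/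
theorem selbergMinorantReal_le_indicator_Icc {Δ : ℝ} (hΔ : 0 < Δ) (a b x : ℝ) :
    selbergMinorantReal Δ a b x ≤ (Icc a b).indicator (fun _ ↦ (1 : ℝ)) x :=
  (selbergMinorantReal_le_indicator hΔ a b x).trans
    (Set.indicator_le_indicator_of_subset Ioo_subset_Icc_self (fun _ ↦ zero_le_one) x)

/-! ## (ii) The `L¹` distance to the indicator is exactly `1/Δ` -/

/-- `sgn(Δu) = sgn(u)` for `Δ > 0`. [folklore] -/
lemma sign_mul_of_pos {Δ : ℝ} (hΔ : 0 < Δ) (u : ℝ) : Real.sign (Δ * u) = Real.sign u := by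
  rcases lt_trichotomy u 0 with hu | rfl | hu
  · rw [Real.sign_of_neg hu, Real.sign_of_neg (by nlinarith)]
  · rw [mul_zero]
  · rw [Real.sign_of_pos hu, Real.sign_of_pos (by nlinarith)]

/-- `F₊ − 𝟙_{[a,b]}` in terms of `B − sgn`, off the endpoints. [cite: Vaaler1985, Thm. 8 (proof)] -/
theorem selbergMajorantReal_sub_indicator_eq {Δ a b x : ℝ} (hΔ : 0 < Δ) (hab : a ≤ b)
    (hxa : x ≠ a) (hxb : x ≠ b) :
    selbergMajorantReal Δ a b x - (Icc a b).indicator (fun _ ↦ (1 : ℝ)) x =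
      ((beurlingReal (Δ * (x - a)) - Real.sign (Δ * (x - a))) +
        (beurlingReal (Δ * (b - x)) - Real.sign (Δ * (b - x)))) / 2 := by
  unfold selbergMajorantReal
  rw [sign_mul_of_pos hΔ, sign_mul_of_pos hΔ]
  by_cases hx : x ∈ Icc a b
  · rw [indicator_of_mem hx, Real.sign_of_pos (by rcases hx.1.lt_or_eq with h | h <;> [linarith; exact absurd h.symm hxa]),
      Real.sign_of_pos (by rcases hx.2.lt_or_eq with h | h <;> [linarith; exact absurd h hxb])]
    ring
  · rw [indicator_of_notMem hx]
    rw [mem_Icc, not_and_or, not_le, not_le] at hx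
    rcases hx with hx | hx
    · rw [Real.sign_of_neg (by linarith), Real.sign_of_pos (by linarith)]; ring
    · rw [Real.sign_of_pos (by linarith), Real.sign_of_neg (by linarith)]; ring

/-- `𝟙_{[a,b]} − F₋` in terms of `B − sgn`, off the endpoints. [cite: Vaaler1985, Thm. 8 (proof)] -/
theorem indicator_sub_selbergMinorantReal_eq {Δ a b x : ℝ} (hΔ : 0 < Δ) (hab : a ≤ b)
    (hxa : x ≠ a) (hxb : x ≠ b) :
    (Icc a b).indicator (fun _ ↦ (1 : ℝ)) x - selbergMinorantReal Δ a b x =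
      ((beurlingReal (Δ * (a - x)) - Real.sign (Δ * (a - x))) +
        (beurlingReal (Δ * (x - b)) - Real.sign (Δ * (x - b)))) / 2 := by
  unfold selbergMinorantReal
  rw [sign_mul_of_pos hΔ, sign_mul_of_pos hΔ]
  by_cases hx : x ∈ Icc a b
  · rw [indicator_of_mem hx, Real.sign_of_neg (by rcases hx.1.lt_or_eq with h | h <;> [linarith; exact absurd h.symm hxa]),
      Real.sign_of_neg (by rcases hx.2.lt_or_eq with h | h <;> [linarith; exact absurd h hxb])]
    ring
  · rw [indicator_of_notMem hx]
    rw [mem_Icc, not_and_or, not_le, not_le] at hx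
    rcases hx with hx | hx
    · rw [Real.sign_of_pos (by linarith), Real.sign_of_neg (by linarith)]; ring
    · rw [Real.sign_of_neg (by linarith), Real.sign_of_pos (by linarith)]; ring

/-- Integrability and integral of the rescaled pieces `x ↦ B(Δ(x−a)) − sgn(Δ(x−a))`. [folklore] -/
theorem integrable_beurlingReal_sub_sign_comp_sub {Δ : ℝ} (hΔ : Δ ≠ 0) (a : ℝ) :
    Integrable fun x : ℝ ↦ beurlingReal (Δ * (x - a)) - Real.sign (Δ * (x - a)) := by
  have h := (integrable_beurlingReal_sub_sign.comp_mul_left' hΔ).comp_sub_right a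
  exact h

/-- `∫ (B(Δ(x−a)) − sgn(Δ(x−a))) dx = 1/Δ`. [cite: Vaaler1985, Thm. 8 (proof)] -/
theorem integral_beurlingReal_sub_sign_comp_sub {Δ : ℝ} (hΔ : 0 < Δ) (a : ℝ) :
    ∫ x : ℝ, (beurlingReal (Δ * (x - a)) - Real.sign (Δ * (x - a))) = 1 / Δ := by
  have h1 := integral_sub_right_eq_self (μ := volume)
    (fun y : ℝ ↦ beurlingReal (Δ * y) - Real.sign (Δ * y)) a
  rw [h1, Measure.integral_comp_mul_left (fun y : ℝ ↦ beurlingReal y - Real.sign y) Δ,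
    integral_beurlingReal_sub_sign, abs_of_pos (inv_pos.2 hΔ), smul_eq_mul, mul_one, one_div]

/-- Integrability of `x ↦ B(Δ(b−x)) − sgn(Δ(b−x))`. [folklore] -/
theorem integrable_beurlingReal_sub_sign_comp_sub' {Δ : ℝ} (hΔ : Δ ≠ 0) (b : ℝ) :
    Integrable fun x : ℝ ↦ beurlingReal (Δ * (b - x)) - Real.sign (Δ * (b - x)) := by
  have h := (integrable_beurlingReal_sub_sign.comp_mul_left' (neg_ne_zero.2 hΔ)).comp_sub_right b
  refine h.congr (Eventually.of_forall fun x ↦ ?_)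
  beta_reduce
  ring_nf

/-- `∫ (B(Δ(b−x)) − sgn(Δ(b−x))) dx = 1/Δ`. [cite: Vaaler1985, Thm. 8 (proof)] -/
theorem integral_beurlingReal_sub_sign_comp_sub' {Δ : ℝ} (hΔ : 0 < Δ) (b : ℝ) :
    ∫ x : ℝ, (beurlingReal (Δ * (b - x)) - Real.sign (Δ * (b - x))) = 1 / Δ := by
  have h1 := integral_sub_right_eq_self (μ := volume)
    (fun y : ℝ ↦ beurlingReal (-Δ * y) - Real.sign (-Δ * y)) b
  have h2 : (fun x : ℝ ↦ beurlingReal (Δ * (b - x)) - Real.sign (Δ * (b - x))) =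
      fun x : ℝ ↦ beurlingReal (-Δ * (x - b)) - Real.sign (-Δ * (x - b)) := by
    funext x; ring_nf
  rw [h2, h1, Measure.integral_comp_mul_left (fun y : ℝ ↦ beurlingReal y - Real.sign y) (-Δ),
    integral_beurlingReal_sub_sign, smul_eq_mul, mul_one, inv_neg, abs_neg,
    abs_of_pos (inv_pos.2 hΔ), one_div]

/-- The endpoints form a null set. [folklore] -/
lemma ae_ne_endpoints (a b : ℝ) : ∀ᵐ x : ℝ, x ≠ a ∧ x ≠ b := by
  have h : ({a, b} : Set ℝ).Countable := (Set.toFinite _).countable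
  filter_upwards [h.ae_notMem volume] with x hx
  simp only [mem_insert_iff, mem_singleton_iff, not_or] at hx
  exact hx

/-- `F₊ − 𝟙_{[a,b]}` is integrable. [cite: Vaaler1985, Thm. 8] -/
theorem integrable_selbergMajorantReal_sub_indicator {Δ a b : ℝ} (hΔ : 0 < Δ) (hab : a ≤ b) :
    Integrable fun x ↦ selbergMajorantReal Δ a b x - (Icc a b).indicator (fun _ ↦ (1 : ℝ)) x := by
  have h := ((integrable_beurlingReal_sub_sign_comp_sub hΔ.ne' a).add
    (integrable_beurlingReal_sub_sign_comp_sub' hΔ.ne' b)).div_const 2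
  refine h.congr ?_
  filter_upwards [ae_ne_endpoints a b] with x hx
  rw [selbergMajorantReal_sub_indicator_eq hΔ hab hx.1 hx.2]
  simp only [Pi.add_apply]

/-- **`∫ (F₊ − 𝟙_{[a,b]}) = 1/Δ`.** [cite: Vaaler1985, Thm. 8] -/
theorem integral_selbergMajorantReal_sub_indicator {Δ a b : ℝ} (hΔ : 0 < Δ) (hab : a ≤ b) :
    ∫ x, (selbergMajorantReal Δ a b x - (Icc a b).indicator (fun _ ↦ (1 : ℝ)) x) = 1 / Δ := by
  have h : ∫ x, (selbergMajorantReal Δ a b x - (Icc a b).indicator (fun _ ↦ (1 : ℝ)) x) =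
      ∫ x, ((beurlingReal (Δ * (x - a)) - Real.sign (Δ * (x - a))) +
        (beurlingReal (Δ * (b - x)) - Real.sign (Δ * (b - x)))) / 2 := by
    refine integral_congr_ae ?_
    filter_upwards [ae_ne_endpoints a b] with x hx
    exact selbergMajorantReal_sub_indicator_eq hΔ hab hx.1 hx.2
  rw [h, integral_div, integral_add (integrable_beurlingReal_sub_sign_comp_sub hΔ.ne' a)
    (integrable_beurlingReal_sub_sign_comp_sub' hΔ.ne' b), integral_beurlingReal_sub_sign_comp_sub hΔ,
    integral_beurlingReal_sub_sign_comp_sub' hΔ]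
  ring

/-- `𝟙_{[a,b]} − F₋` is integrable. [cite: Vaaler1985, Thm. 8] -/
theorem integrable_indicator_sub_selbergMinorantReal {Δ a b : ℝ} (hΔ : 0 < Δ) (hab : a ≤ b) :
    Integrable fun x ↦ (Icc a b).indicator (fun _ ↦ (1 : ℝ)) x - selbergMinorantReal Δ a b x := by
  have h := ((integrable_beurlingReal_sub_sign_comp_sub' hΔ.ne' a).add
    (integrable_beurlingReal_sub_sign_comp_sub hΔ.ne' b)).div_const 2
  refine h.congr ?_
  filter_upwards [ae_ne_endpoints a b] with x hx
  rw [indicator_sub_selbergMinorantReal_eq hΔ hab hx.1 hx.2]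
  simp only [Pi.add_apply]

/-- **`∫ (𝟙_{[a,b]} − F₋) = 1/Δ`.** [cite: Vaaler1985, Thm. 8] -/
theorem integral_indicator_sub_selbergMinorantReal {Δ a b : ℝ} (hΔ : 0 < Δ) (hab : a ≤ b) :
    ∫ x, ((Icc a b).indicator (fun _ ↦ (1 : ℝ)) x - selbergMinorantReal Δ a b x) = 1 / Δ := by
  have h : ∫ x, ((Icc a b).indicator (fun _ ↦ (1 : ℝ)) x - selbergMinorantReal Δ a b x) =
      ∫ x, ((beurlingReal (Δ * (a - x)) - Real.sign (Δ * (a - x))) +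
        (beurlingReal (Δ * (x - b)) - Real.sign (Δ * (x - b)))) / 2 := by
    refine integral_congr_ae ?_
    filter_upwards [ae_ne_endpoints a b] with x hx
    exact indicator_sub_selbergMinorantReal_eq hΔ hab hx.1 hx.2
  rw [h, integral_div, integral_add (integrable_beurlingReal_sub_sign_comp_sub' hΔ.ne' a)
    (integrable_beurlingReal_sub_sign_comp_sub hΔ.ne' b), integral_beurlingReal_sub_sign_comp_sub' hΔ,
    integral_beurlingReal_sub_sign_comp_sub hΔ]
  ring

/-- The indicator of `[a,b]` is integrable with integral `b − a`. [folklore] -/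
theorem integrable_indicator_Icc (a b : ℝ) :
    Integrable fun x ↦ (Icc a b).indicator (fun _ ↦ (1 : ℝ)) x :=
  ((continuous_const (y := (1 : ℝ))).integrableOn_Icc (a := a) (b := b)).integrable_indicator
    measurableSet_Icc

/-- `∫ 𝟙_{[a,b]} = b − a`. [folklore] -/
theorem integral_indicator_Icc {a b : ℝ} (hab : a ≤ b) :
    ∫ x, (Icc a b).indicator (fun _ ↦ (1 : ℝ)) x = b - a := by
  rw [integral_indicator measurableSet_Icc, setIntegral_const, smul_eq_mul, mul_one,
    Real.volume_real_Icc_of_le hab]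

/-- `F₊` is integrable on `ℝ` and **`∫ F₊ = (b − a) + 1/Δ`**. [cite: Vaaler1985, Thm. 8] -/
theorem integrable_selbergMajorantReal {Δ a b : ℝ} (hΔ : 0 < Δ) (hab : a ≤ b) :
    Integrable (selbergMajorantReal Δ a b) := by
  have h := (integrable_selbergMajorantReal_sub_indicator hΔ hab).add (integrable_indicator_Icc a b)
  refine h.congr (Eventually.of_forall fun x ↦ ?_)
  simp

/-- **`∫ F₊ = (b − a) + 1/Δ`** (i.e. `F̂₊(0) = 2h + 1/Δ` for `[−h,h]`). [cite: Vaaler1985, Thm. 8; BalazardDeRoton2008, Prop. 10 (ii)] -/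
theorem integral_selbergMajorantReal {Δ a b : ℝ} (hΔ : 0 < Δ) (hab : a ≤ b) :
    ∫ x, selbergMajorantReal Δ a b x = (b - a) + 1 / Δ := by
  have h : (selbergMajorantReal Δ a b) = fun x ↦
      (selbergMajorantReal Δ a b x - (Icc a b).indicator (fun _ ↦ (1 : ℝ)) x) +
        (Icc a b).indicator (fun _ ↦ (1 : ℝ)) x := by
    funext x; simp
  rw [h, integral_add (integrable_selbergMajorantReal_sub_indicator hΔ hab) (integrable_indicator_Icc a b),
    integral_selbergMajorantReal_sub_indicator hΔ hab, integral_indicator_Icc hab]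
  ring

/-- `F₋` is integrable on `ℝ` and **`∫ F₋ = (b − a) − 1/Δ`**. [cite: Vaaler1985, Thm. 8] -/
theorem integrable_selbergMinorantReal {Δ a b : ℝ} (hΔ : 0 < Δ) (hab : a ≤ b) :
    Integrable (selbergMinorantReal Δ a b) := by
  have h := (integrable_indicator_Icc a b).sub (integrable_indicator_sub_selbergMinorantReal hΔ hab)
  refine h.congr (Eventually.of_forall fun x ↦ ?_)
  simp

/-- **`∫ F₋ = (b − a) − 1/Δ`** (i.e. `F̂₋(0) = 2h − 1/Δ` for `[−h,h]`). [cite: Vaaler1985, Thm. 8; BalazardDeRoton2008, Prop. 10 (ii)] -/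
theorem integral_selbergMinorantReal {Δ a b : ℝ} (hΔ : 0 < Δ) (hab : a ≤ b) :
    ∫ x, selbergMinorantReal Δ a b x = (b - a) - 1 / Δ := by
  have h : (selbergMinorantReal Δ a b) = fun x ↦
      (Icc a b).indicator (fun _ ↦ (1 : ℝ)) x -
        ((Icc a b).indicator (fun _ ↦ (1 : ℝ)) x - selbergMinorantReal Δ a b x) := by
    funext x; simp
  rw [h, integral_sub (integrable_indicator_Icc a b) (integrable_indicator_sub_selbergMinorantReal hΔ hab),
    integral_indicator_sub_selbergMinorantReal hΔ hab, integral_indicator_Icc hab]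

/-! ## Symmetry for a symmetric interval -/

/-- For the symmetric interval `[−h, h]` the majorant is even. [folklore] -/
theorem selbergMajorant_symm_neg (Δ h : ℝ) (z : ℂ) :
    selbergMajorant Δ (-h) h (-z) = selbergMajorant Δ (-h) h z := by
  unfold selbergMajorant
  push_cast
  ring_nf

/-- For `[−h, h]` the real majorant is even. [folklore] -/
theorem selbergMajorantReal_symm_neg (Δ h x : ℝ) :
    selbergMajorantReal Δ (-h) h (-x) = selbergMajorantReal Δ (-h) h x := by
  unfold selbergMajorantReal
  ring_nf

/-- For the symmetric interval `[−h, h]` the minorant is even. [folklore] -/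
theorem selbergMinorant_symm_neg (Δ h : ℝ) (z : ℂ) :
    selbergMinorant Δ (-h) h (-z) = selbergMinorant Δ (-h) h z := by
  unfold selbergMinorant
  push_cast
  ring_nf

/-- For `[−h, h]` the real minorant is even. [folklore] -/
theorem selbergMinorantReal_symm_neg (Δ h x : ℝ) :
    selbergMinorantReal Δ (-h) h (-x) = selbergMinorantReal Δ (-h) h x := by
  unfold selbergMinorantReal
  ring_nf

/-! ## (iv) Growth in the complex plane: exponential type `2πΔ` and decay `(Δ·dist)⁻²` -/

/-- `|Im(Δ(z−a))| = Δ|Im z|`. [folklore] -/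
lemma abs_im_mul_sub (Δ a : ℝ) (hΔ : 0 < Δ) (z : ℂ) : |((Δ : ℂ) * (z - a)).im| = Δ * |z.im| := by
  simp [abs_mul, abs_of_pos hΔ]

/-- `|Im(Δ(b−z))| = Δ|Im z|`. [folklore] -/
lemma abs_im_mul_sub' (Δ b : ℝ) (hΔ : 0 < Δ) (z : ℂ) : |((Δ : ℂ) * (b - z)).im| = Δ * |z.im| := by
  simp [abs_mul, abs_of_pos hΔ]

/-- **Exponential type**: `|F₊(z)| ≤ 3e^{2π} e^{2πΔ|Im z|}`. [cite: Vaaler1985, Thm. 8] -/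
theorem norm_selbergMajorant_le {Δ : ℝ} (hΔ : 0 < Δ) (a b : ℝ) (z : ℂ) :
    ‖selbergMajorant Δ a b z‖ ≤ 3 * Real.exp (2 * π) * Real.exp (2 * π * Δ * |z.im|) := by
  unfold selbergMajorant
  have h1 := norm_beurling_le ((Δ : ℂ) * (z - a))
  have h2 := norm_beurling_le ((Δ : ℂ) * (b - z))
  rw [abs_im_mul_sub Δ a hΔ z] at h1
  rw [abs_im_mul_sub' Δ b hΔ z] at h2
  have he : Real.exp (2 * π * (Δ * |z.im|)) = Real.exp (2 * π * Δ * |z.im|) := by ring_nf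
  rw [he] at h1 h2
  rw [norm_div, Complex.norm_two]
  calc ‖beurling (Δ * (z - a)) + beurling (Δ * (b - z))‖ / 2
      ≤ (‖beurling (Δ * (z - a))‖ + ‖beurling (Δ * (b - z))‖) / 2 := by
        gcongr; exact norm_add_le _ _
    _ ≤ (3 * Real.exp (2 * π) * Real.exp (2 * π * Δ * |z.im|) +
          3 * Real.exp (2 * π) * Real.exp (2 * π * Δ * |z.im|)) / 2 := by gcongr
    _ = 3 * Real.exp (2 * π) * Real.exp (2 * π * Δ * |z.im|) := by ring

/-- **Exponential type**: `|F₋(z)| ≤ 3e^{2π} e^{2πΔ|Im z|}`. [cite: Vaaler1985, Thm. 8] -/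
theorem norm_selbergMinorant_le {Δ : ℝ} (hΔ : 0 < Δ) (a b : ℝ) (z : ℂ) :
    ‖selbergMinorant Δ a b z‖ ≤ 3 * Real.exp (2 * π) * Real.exp (2 * π * Δ * |z.im|) := by
  rw [selbergMinorant_eq_neg_selbergMajorant, norm_neg]
  exact norm_selbergMajorant_le hΔ b a z

/-- **Far-field decay to the right**: for `Re z ≥ max(a,b) + 1/Δ`,
`|F₊(z)| ≤ (3/2) e^{2πΔ|Im z|} / (Δ² (Re z − max(a,b))²)`. [cite: Vaaler1985, Thm. 8; BalazardDeRoton2008, Prop. 10 (iv)] -/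
theorem norm_selbergMajorant_le_of_le_re {Δ a b : ℝ} (hΔ : 0 < Δ) {z : ℂ}
    (hz : max a b + 1 / Δ ≤ z.re) :
    ‖selbergMajorant Δ a b z‖ ≤
      3 / 2 * Real.exp (2 * π * Δ * |z.im|) / (Δ ^ 2 * (z.re - max a b) ^ 2) := by
  set d : ℝ := z.re - max a b with hd
  have hd1 : 1 / Δ ≤ d := by rw [hd]; linarith
  have hΔd : 1 ≤ Δ * d := by
    have := mul_le_mul_of_nonneg_left hd1 hΔ.le
    rwa [mul_one_div_cancel hΔ.ne'] at this
  have hd0 : 0 < d := by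
    have : 0 < 1 / Δ := by positivity
    linarith
  set w₁ : ℂ := (Δ : ℂ) * (z - a) with hw₁
  set w₂ : ℂ := (Δ : ℂ) * (b - z) with hw₂
  have hre1 : w₁.re = Δ * (z.re - a) := by simp [hw₁]
  have hre2 : w₂.re = Δ * (b - z.re) := by simp [hw₂]
  have ha : a ≤ max a b := le_max_left a b
  have hb : b ≤ max a b := le_max_right a b
  have hre1' : Δ * d ≤ w₁.re := by rw [hre1, hd]; nlinarith
  have hre2' : w₂.re ≤ -(Δ * d) := by rw [hre2, hd]; nlinarith
  have hn1 : Δ * d ≤ ‖w₁‖ := hre1'.trans (Complex.re_le_norm w₁)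
  have hn2 : Δ * d ≤ ‖w₂‖ := by
    have := Complex.abs_re_le_norm w₂
    have h' : Δ * d ≤ |w₂.re| := by rw [abs_of_nonpos (by nlinarith)]; linarith
    exact h'.trans this
  have hB1 := norm_beurling_sub_one_le (by linarith : 0 ≤ w₁.re) (hΔd.trans hn1)
  have hB2 := norm_beurling_add_one_le (by nlinarith : w₂.re ≤ 0) (hΔd.trans hn2)
  rw [show |w₁.im| = Δ * |z.im| from abs_im_mul_sub Δ a hΔ z] at hB1
  rw [show |w₂.im| = Δ * |z.im| from abs_im_mul_sub' Δ b hΔ z] at hB2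
  have he : Real.exp (2 * π * (Δ * |z.im|)) = Real.exp (2 * π * Δ * |z.im|) := by ring_nf
  rw [he] at hB1 hB2
  set E : ℝ := Real.exp (2 * π * Δ * |z.im|) with hE
  have hE0 : 0 < E := Real.exp_pos _
  have hΔd0 : 0 < Δ * d := by positivity
  have hfrac1 : E / ‖w₁‖ ^ 2 ≤ E / (Δ * d) ^ 2 := by
    apply div_le_div_of_nonneg_left hE0.le (by positivity)
    exact pow_le_pow_left₀ hΔd0.le hn1 2
  have hfrac2 : 2 * E / ‖w₂‖ ^ 2 ≤ 2 * E / (Δ * d) ^ 2 := by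
    apply div_le_div_of_nonneg_left (by positivity) (by positivity)
    exact pow_le_pow_left₀ hΔd0.le hn2 2
  have hid : selbergMajorant Δ a b z = ((beurling w₁ - 1) + (beurling w₂ + 1)) / 2 := by
    unfold selbergMajorant; rw [hw₁, hw₂]; ring
  rw [hid, norm_div, Complex.norm_two]
  calc ‖(beurling w₁ - 1) + (beurling w₂ + 1)‖ / 2
      ≤ (‖beurling w₁ - 1‖ + ‖beurling w₂ + 1‖) / 2 := by gcongr; exact norm_add_le _ _
    _ ≤ (E / (Δ * d) ^ 2 + 2 * E / (Δ * d) ^ 2) / 2 := by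
        gcongr
        · exact hB1.trans hfrac1
        · exact hB2.trans hfrac2
    _ = 3 / 2 * E / (Δ ^ 2 * d ^ 2) := by
        field_simp
        ring

/-- **Far-field decay to the left**: for `Re z ≤ min(a,b) − 1/Δ`,
`|F₊(z)| ≤ (3/2) e^{2πΔ|Im z|} / (Δ² (min(a,b) − Re z)²)`. [cite: Vaaler1985, Thm. 8; BalazardDeRoton2008, Prop. 10 (iv)] -/
theorem norm_selbergMajorant_le_of_re_le {Δ a b : ℝ} (hΔ : 0 < Δ) {z : ℂ}
    (hz : z.re ≤ min a b - 1 / Δ) :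
    ‖selbergMajorant Δ a b z‖ ≤
      3 / 2 * Real.exp (2 * π * Δ * |z.im|) / (Δ ^ 2 * (min a b - z.re) ^ 2) := by
  set d : ℝ := min a b - z.re with hd
  have hd1 : 1 / Δ ≤ d := by rw [hd]; linarith
  have hΔd : 1 ≤ Δ * d := by
    have := mul_le_mul_of_nonneg_left hd1 hΔ.le
    rwa [mul_one_div_cancel hΔ.ne'] at this
  have hd0 : 0 < d := by
    have : 0 < 1 / Δ := by positivity
    linarith
  set w₁ : ℂ := (Δ : ℂ) * (z - a) with hw₁
  set w₂ : ℂ := (Δ : ℂ) * (b - z) with hw₂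
  have hre1 : w₁.re = Δ * (z.re - a) := by simp [hw₁]
  have hre2 : w₂.re = Δ * (b - z.re) := by simp [hw₂]
  have ha : min a b ≤ a := min_le_left a b
  have hb : min a b ≤ b := min_le_right a b
  have hre1' : w₁.re ≤ -(Δ * d) := by rw [hre1, hd]; nlinarith
  have hre2' : Δ * d ≤ w₂.re := by rw [hre2, hd]; nlinarith
  have hn2 : Δ * d ≤ ‖w₂‖ := hre2'.trans (Complex.re_le_norm w₂)
  have hn1 : Δ * d ≤ ‖w₁‖ := by
    have := Complex.abs_re_le_norm w₁
    have h' : Δ * d ≤ |w₁.re| := by rw [abs_of_nonpos (by nlinarith)]; linarith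
    exact h'.trans this
  have hB1 := norm_beurling_add_one_le (by nlinarith : w₁.re ≤ 0) (hΔd.trans hn1)
  have hB2 := norm_beurling_sub_one_le (by linarith : 0 ≤ w₂.re) (hΔd.trans hn2)
  rw [show |w₁.im| = Δ * |z.im| from abs_im_mul_sub Δ a hΔ z] at hB1
  rw [show |w₂.im| = Δ * |z.im| from abs_im_mul_sub' Δ b hΔ z] at hB2
  have he : Real.exp (2 * π * (Δ * |z.im|)) = Real.exp (2 * π * Δ * |z.im|) := by ring_nf
  rw [he] at hB1 hB2
  set E : ℝ := Real.exp (2 * π * Δ * |z.im|) with hE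
  have hE0 : 0 < E := Real.exp_pos _
  have hΔd0 : 0 < Δ * d := by positivity
  have hfrac1 : 2 * E / ‖w₁‖ ^ 2 ≤ 2 * E / (Δ * d) ^ 2 := by
    apply div_le_div_of_nonneg_left (by positivity) (by positivity)
    exact pow_le_pow_left₀ hΔd0.le hn1 2
  have hfrac2 : E / ‖w₂‖ ^ 2 ≤ E / (Δ * d) ^ 2 := by
    apply div_le_div_of_nonneg_left hE0.le (by positivity)
    exact pow_le_pow_left₀ hΔd0.le hn2 2
  have hid : selbergMajorant Δ a b z = ((beurling w₁ + 1) + (beurling w₂ - 1)) / 2 := by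
    unfold selbergMajorant; rw [hw₁, hw₂]; ring
  rw [hid, norm_div, Complex.norm_two]
  calc ‖(beurling w₁ + 1) + (beurling w₂ - 1)‖ / 2
      ≤ (‖beurling w₁ + 1‖ + ‖beurling w₂ - 1‖) / 2 := by gcongr; exact norm_add_le _ _
    _ ≤ (2 * E / (Δ * d) ^ 2 + E / (Δ * d) ^ 2) / 2 := by
        gcongr
        · exact hB1.trans hfrac1
        · exact hB2.trans hfrac2
    _ = 3 / 2 * E / (Δ ^ 2 * d ^ 2) := by
        field_simp
        ring

/-- Far-field decay of the minorant, right. [cite: Vaaler1985, Thm. 8; BalazardDeRoton2008, Prop. 10 (iv)] -/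
theorem norm_selbergMinorant_le_of_le_re {Δ a b : ℝ} (hΔ : 0 < Δ) {z : ℂ}
    (hz : max a b + 1 / Δ ≤ z.re) :
    ‖selbergMinorant Δ a b z‖ ≤
      3 / 2 * Real.exp (2 * π * Δ * |z.im|) / (Δ ^ 2 * (z.re - max a b) ^ 2) := by
  rw [selbergMinorant_eq_neg_selbergMajorant, norm_neg, max_comm]
  exact norm_selbergMajorant_le_of_le_re hΔ (by rwa [max_comm])

/-- Far-field decay of the minorant, left. [cite: Vaaler1985, Thm. 8; BalazardDeRoton2008, Prop. 10 (iv)] -/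
theorem norm_selbergMinorant_le_of_re_le {Δ a b : ℝ} (hΔ : 0 < Δ) {z : ℂ}
    (hz : z.re ≤ min a b - 1 / Δ) :
    ‖selbergMinorant Δ a b z‖ ≤
      3 / 2 * Real.exp (2 * π * Δ * |z.im|) / (Δ ^ 2 * (min a b - z.re) ^ 2) := by
  rw [selbergMinorant_eq_neg_selbergMajorant, norm_neg, min_comm]
  exact norm_selbergMajorant_le_of_re_le hΔ (by rwa [min_comm])

/-- `1/(Δ²u²) ≤ (1 + Δ⁻²)(1 + u²)⁻¹` once `Δu ≥ 1`. [folklore] -/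
lemma inv_sq_le_of_one_le {Δ u : ℝ} (hΔ : 0 < Δ) (h : 1 ≤ Δ * u) :
    1 / (Δ ^ 2 * u ^ 2) ≤ (1 + (Δ ^ 2)⁻¹) * (1 + u ^ 2)⁻¹ := by
  have hu : 0 < u := by
    by_contra hcon
    rw [not_lt] at hcon
    nlinarith
  rw [← div_eq_mul_inv, div_le_div_iff₀ (by positivity) (by positivity)]
  have h2 : 1 ≤ Δ ^ 2 * u ^ 2 := by nlinarith
  field_simp
  nlinarith

/-- **An integrable majorant on horizontal lines**: there is `K > 0` with
`|F₊(z)| ≤ K e^{2πΔ|Im z|} ((1 + (Re z − a)²)⁻¹ + (1 + (Re z − b)²)⁻¹)` for all `z`.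
[cite: Vaaler1985, Thm. 8; BalazardDeRoton2008, Prop. 10 (iv)] -/
theorem exists_norm_selbergMajorant_le {Δ : ℝ} (hΔ : 0 < Δ) (a b : ℝ) :
    ∃ K : ℝ, 0 < K ∧ ∀ z : ℂ, ‖selbergMajorant Δ a b z‖ ≤
      K * Real.exp (2 * π * Δ * |z.im|) * ((1 + (z.re - a) ^ 2)⁻¹ + (1 + (z.re - b) ^ 2)⁻¹) := by
  set L : ℝ := max a b - min a b + 1 / Δ with hL
  have hL0 : 0 < L := by
    have : min a b ≤ max a b := min_le_max
    have : 0 < 1 / Δ := by positivity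
    rw [hL]; linarith
  set K : ℝ := 3 / 2 * (1 + (Δ ^ 2)⁻¹) + 3 * Real.exp (2 * π) * (1 + L ^ 2) with hK
  have hK0 : 0 < K := by positivity
  refine ⟨K, hK0, fun z ↦ ?_⟩
  set x := z.re with hx
  set E : ℝ := Real.exp (2 * π * Δ * |z.im|) with hE
  have hE0 : 0 < E := Real.exp_pos _
  have hIa : 0 < (1 + (x - a) ^ 2)⁻¹ := by positivity
  have hIb : 0 < (1 + (x - b) ^ 2)⁻¹ := by positivity
  have hK1 : 3 / 2 * (1 + (Δ ^ 2)⁻¹) ≤ K := by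
    rw [hK]; nlinarith [Real.exp_pos (2 * π), sq_nonneg L]
  have hK2 : 3 * Real.exp (2 * π) * (1 + L ^ 2) ≤ K := by
    rw [hK]
    have : 0 ≤ 3 / 2 * (1 + (Δ ^ 2)⁻¹) := by positivity
    linarith
  rcases le_or_gt (max a b + 1 / Δ) x with hfar | hnear
  · -- far right
    have h := norm_selbergMajorant_le_of_le_re (a := a) (b := b) hΔ (z := z) hfar
    have hd : 1 ≤ Δ * (x - max a b) := by
      have : 1 / Δ ≤ x - max a b := by linarith
      have h2 := mul_le_mul_of_nonneg_left this hΔ.le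
      rwa [mul_one_div_cancel hΔ.ne'] at h2
    have hmax : (1 + (x - max a b) ^ 2)⁻¹ ≤ (1 + (x - a) ^ 2)⁻¹ + (1 + (x - b) ^ 2)⁻¹ := by
      rcases le_total a b with hab | hab
      · rw [max_eq_right hab]; linarith
      · rw [max_eq_left hab]; linarith
    calc ‖selbergMajorant Δ a b z‖ ≤ 3 / 2 * E / (Δ ^ 2 * (x - max a b) ^ 2) := h
      _ = 3 / 2 * E * (1 / (Δ ^ 2 * (x - max a b) ^ 2)) := by ring
      _ ≤ 3 / 2 * E * ((1 + (Δ ^ 2)⁻¹) * (1 + (x - max a b) ^ 2)⁻¹) := by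
          gcongr; exact inv_sq_le_of_one_le hΔ hd
      _ = 3 / 2 * (1 + (Δ ^ 2)⁻¹) * E * (1 + (x - max a b) ^ 2)⁻¹ := by ring
      _ ≤ K * E * ((1 + (x - a) ^ 2)⁻¹ + (1 + (x - b) ^ 2)⁻¹) := by
          gcongr
  rcases le_or_gt x (min a b - 1 / Δ) with hfar | hnear'
  · -- far left
    have h := norm_selbergMajorant_le_of_re_le (a := a) (b := b) hΔ (z := z) hfar
    have hd : 1 ≤ Δ * (min a b - x) := by
      have : 1 / Δ ≤ min a b - x := by linarith
      have h2 := mul_le_mul_of_nonneg_left this hΔ.le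
      rwa [mul_one_div_cancel hΔ.ne'] at h2
    have hmin : (1 + (min a b - x) ^ 2)⁻¹ ≤ (1 + (x - a) ^ 2)⁻¹ + (1 + (x - b) ^ 2)⁻¹ := by
      rcases le_total a b with hab | hab
      · rw [min_eq_left hab, show (a - x) ^ 2 = (x - a) ^ 2 by ring]; linarith
      · rw [min_eq_right hab, show (b - x) ^ 2 = (x - b) ^ 2 by ring]; linarith
    calc ‖selbergMajorant Δ a b z‖ ≤ 3 / 2 * E / (Δ ^ 2 * (min a b - x) ^ 2) := h
      _ = 3 / 2 * E * (1 / (Δ ^ 2 * (min a b - x) ^ 2)) := by ring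
      _ ≤ 3 / 2 * E * ((1 + (Δ ^ 2)⁻¹) * (1 + (min a b - x) ^ 2)⁻¹) := by
          gcongr; exact inv_sq_le_of_one_le hΔ hd
      _ = 3 / 2 * (1 + (Δ ^ 2)⁻¹) * E * (1 + (min a b - x) ^ 2)⁻¹ := by ring
      _ ≤ K * E * ((1 + (x - a) ^ 2)⁻¹ + (1 + (x - b) ^ 2)⁻¹) := by
          gcongr
  · -- near the interval: `|x − a| ≤ L`
    have h := norm_selbergMajorant_le hΔ a b z
    have hxa : (x - a) ^ 2 ≤ L ^ 2 := by
      have h1 : x - a ≤ L := by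
        have : a ≥ min a b := min_le_left a b
        rw [hL]; linarith
      have h2 : -(x - a) ≤ L := by
        have : a ≤ max a b := le_max_left a b
        have : min a b ≤ max a b := min_le_max
        rw [hL]; linarith
      nlinarith [abs_le.2 ⟨by linarith, h1⟩, sq_abs (x - a), abs_nonneg (x - a)]
    have hinv : (1 + L ^ 2)⁻¹ ≤ (1 + (x - a) ^ 2)⁻¹ := by
      apply inv_anti₀ (by positivity); linarith
    calc ‖selbergMajorant Δ a b z‖ ≤ 3 * Real.exp (2 * π) * E := h
      _ = 3 * Real.exp (2 * π) * (1 + L ^ 2) * E * (1 + L ^ 2)⁻¹ := by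
          field_simp
      _ ≤ K * E * ((1 + (x - a) ^ 2)⁻¹ + (1 + (x - b) ^ 2)⁻¹) := by
          have : (1 + L ^ 2)⁻¹ ≤ (1 + (x - a) ^ 2)⁻¹ + (1 + (x - b) ^ 2)⁻¹ := by linarith
          gcongr

/-- The same integrable majorant for `F₋`. [cite: Vaaler1985, Thm. 8; BalazardDeRoton2008, Prop. 10 (iv)] -/
theorem exists_norm_selbergMinorant_le {Δ : ℝ} (hΔ : 0 < Δ) (a b : ℝ) :
    ∃ K : ℝ, 0 < K ∧ ∀ z : ℂ, ‖selbergMinorant Δ a b z‖ ≤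
      K * Real.exp (2 * π * Δ * |z.im|) * ((1 + (z.re - a) ^ 2)⁻¹ + (1 + (z.re - b) ^ 2)⁻¹) := by
  obtain ⟨K, hK, h⟩ := exists_norm_selbergMajorant_le hΔ b a
  refine ⟨K, hK, fun z ↦ ?_⟩
  rw [selbergMinorant_eq_neg_selbergMajorant, norm_neg, add_comm ((1 + (z.re - a) ^ 2)⁻¹)]
  exact h z

end Literature.Analysis.Fourier
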